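import Literature.NumberTheory.Rogawski1990.ArchStableOrbitalWallStepOrbitMeasure   -- ★ p841391 (R1-e′): §1–§2 readings of the state; brings J1 ★ p840417 (`ArchStableTorusOrbitalWallDeriv`), J1-glue ★ p840351, (J-cw), (R1-a), (R1-b′), (R1-f), (δ8)
import HarnessLib

/-!
# The wall constants as DATA: clause-threaded forms of J1 and of the one-step jump (R1-e′) ((D0-1) of (R1-h-d) «signed regrouping»; Rogawski 1990 §8.2 pp. 119–124)

Topic `NumberTheory/Rogawski1990`; namespace `Literature.NumberTheory.Rogawski1990`.  THEOREMS ONLY (no `def`, no instance, no notation, no axiom, no named fact, no `sorry`).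
Cell `pub/hodgecm-mathlib`, ENGINE T1 (crux H413 = `stmt-HodgeConjecture-24833`); floor-2 road «(J-nc) in-house», brick (D0-1) of (R1-h-d) (LEAD F0P3a-plan (g9) WORD T8-119∕T8-120;
F0P3-p03 (g9) 07:01:11Z (2); census `F0/P3a` bus 07:08:19Z); author F0P3a-p07 (g8), 2026-09-01.

WHY.  The (R1-e) chain ★ J1 p840417 → ★ (γ) p840906 → ★ (R1-e′) p841391 → ★ (R1-e″) p841638 → ★ (R1-e-pkg) p841698 → ★ (R1-e-two) p841776 produces the per-place wall constants
`c_w(τ)` of Harish-Chandra's limit formula by `∃` at every layer (J1 `choose`s them out of the letter ★ `ArchLimitFormulaNoncompactWall` and exports only `c τ ≠ 0`).  The END-STATE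
signed regrouping ((R1-h-d): `Σ_ρ (Π_v κ_v(ρ_v)) · Φ(⟦t(z⁰∘ρ)⟧) = C · Φ^{st,e}`) must COMPARE these constants across relabellings ((b1) ★ p842004, (b2′) ★ p842051, uniqueness ★ p841778 —
all phrased «`(c : ℂ) (hc : the (J-nc) clause for c)` ⇒ …») and EVALUATE them ((J-val)), which an anonymous `∃ c` does not allow.  This file re-threads the two bottom layers with the
constants HANDED IN AS DATA together with the (J-nc) clause they satisfy (the `hc` binder of ★ p842004 verbatim, on each relabelled group `G_w(α∘τ)` with a noncompact `{0,2}`-wall, at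
the data `((e_τ⁻¹)_* ν, z₁, νH τ)`); the proofs are those of ★ J1 and ★ (R1-e′) with the `choose`∕`obtain ⟨c, …⟩` line replaced by the hypothesis:
* **`tendsto_deriv_sin_mul_sum_integral_comp_conj_splitCurve_comp_perm_of_clause`** (J1′, torus-integral currency at one place);
* **`tendsto_deriv_sin_mul_sum_integral_pi_update_splitCurve_of_clause`** ((R1-e′)′, all-places orbit-measure currency).
The upper layers ((R1-e″)′, (R1-e-pkg)′, (R1-e-two)′) follow in (D0-2), (D0-3).  Consumers instantiate `c τ` with NAMED constants (e.g. one `C_w` per place, the clause for each `τ`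
transported from a base `τ₀` by ★ p842004 ∕ ★ p842051) and keep every identity of the chain.
HONEST LABEL: HC_CM is proved only modulo the 7 printed citations until rung 0 closes; this file re-threads ★ proofs and pays nothing by itself.

## References
* [Rogawski1990] J. D. Rogawski, *Automorphic Representations of Unitary Groups in Three Variables*, Ann. of Math. Stud. 123 (1990), §8.2 pp. 119, 122–124, §14.5 p. 238.
* [Varadarajan1989] V. S. Varadarajan, *An Introduction to Harmonic Analysis on Semisimple Lie Groups* (1989), §6.4 Thm 22.
* [BorelJacquet1979] A. Borel, H. Jacquet, *Automorphic forms and automorphic representations*, PSPM 33.1 (1979), §4.1.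
* [DeitmarEchterhoff2014] A. Deitmar, S. Echterhoff, *Principles of Harmonic Analysis*, 2nd ed. (2014), Lemma 9.3.3.
-/

set_option autoImplicit false

noncomputable section

open MeasureTheory Measure Filter Topology NumberField NumberField.InfinitePlace NumberField.mixedEmbedding Equiv Function Set
open Literature.MeasureTheory.Group Literature.NumberTheory.Automorphic Literature.NumberTheory.Automorphic.UnitaryGroup
open Literature.LinearAlgebra.Matrix
open scoped Matrix MatrixGroups Matrix.Norms.Operator ContDiff

namespace Literature.NumberTheory.Rogawski1990

/-! ## §1 J1′: one place, torus-integral currency -/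

section OnePlace

variable (L : Type) [Field L] (α : Fin 3 → L) (w : {w : InfinitePlace L // IsComplex w})
  [MeasurableSpace (GL (Fin 3) ℂ)] [BorelSpace (GL (Fin 3) ℂ)]

/-- **J1′ — THE `ψ`-DERIVATIVE JUMP OF THE NORMALISED STABLE TORUS FUNCTION AT A SPLIT-SINGULAR POINT, WITH THE WALL CONSTANTS AS DATA** (clause-threaded form of ★ J1
`exists_tendsto_deriv_sin_mul_sum_integral_comp_conj_splitCurve_comp_perm`: same proof, the letter's `∃ c` replaced by a family `c τ` HANDED IN together with the (J-nc) clause it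
satisfies on every relabelled group `G_w(α∘τ)` with a noncompact `{0,2}`-wall, at the data `((e_τ⁻¹)_* ν, z₁, νH τ)` — the `hc` binder of ★ (b1) `archLimitFormulaNoncompactWall_clause_transport_swap02`
verbatim).  CONCLUSION: along `z_ψ = diag(z₀₀e^{iψ}, z₀₁, z₀₀e^{−iψ})`, `∂_ψ [2 sin ψ · Σ_ρ ∫ Θ(g·diag(z_ψ∘ρ)·g⁻¹) dν] ⟶ Σ_ρ ℓ_ρ` (`ψ → 0+`), `ℓ_ρ = 2·∫ Θ(g·diag(z₀∘ρ)·g⁻¹) dν` at a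
compact wall (★ (J-cw)), `ℓ_ρ = c_{ρ⁻¹} · (singular orbital integral on G_w(α∘ρ⁻¹))` at a noncompact one — so that THE SAME `c` can later be compared across `τ` ((b1) ★ p842004,
(b2′) ★ p842051, uniqueness ★ p841778) and evaluated ((J-val)).  [cite: Rogawski1990, §8.2 p. 124] [cite: Varadarajan1989, §6.4 Thm 22] -/
theorem tendsto_deriv_sin_mul_sum_integral_comp_conj_splitCurve_comp_perm_of_clause
    (hα : ∀ i, α i ≠ 0) (hreal : ∀ i, (w.1.embedding (α i)).im = 0)
    (ν : Measure (archLocal L 3 (Matrix.diagonal α) w)) [ν.IsHaarMeasure] [ν.IsMulRightInvariant]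
    (z₁ : Fin 3 → Circle) (h02 : z₁ 0 = z₁ 2) (h01 : z₁ 0 ≠ z₁ 1)
    [∀ τ : Perm (Fin 3), MeasurableSpace (archLocal L 3 (Matrix.diagonal (α ∘ ⇑τ)) w ⧸ Subgroup.centralizer
      ({(⟨circleDiagonal 3 z₁, circleDiagonal_mem_archLocal_diagonal L 3 (α ∘ ⇑τ) w z₁⟩ : archLocal L 3 (Matrix.diagonal (α ∘ ⇑τ)) w)} :
        Set (archLocal L 3 (Matrix.diagonal (α ∘ ⇑τ)) w)))]
    [∀ τ : Perm (Fin 3), BorelSpace (archLocal L 3 (Matrix.diagonal (α ∘ ⇑τ)) w ⧸ Subgroup.centralizer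
      ({(⟨circleDiagonal 3 z₁, circleDiagonal_mem_archLocal_diagonal L 3 (α ∘ ⇑τ) w z₁⟩ : archLocal L 3 (Matrix.diagonal (α ∘ ⇑τ)) w)} :
        Set (archLocal L 3 (Matrix.diagonal (α ∘ ⇑τ)) w)))]
    (νH : ∀ τ : Perm (Fin 3), Measure (Subgroup.centralizer
      ({(⟨circleDiagonal 3 z₁, circleDiagonal_mem_archLocal_diagonal L 3 (α ∘ ⇑τ) w z₁⟩ : archLocal L 3 (Matrix.diagonal (α ∘ ⇑τ)) w)} :
        Set (archLocal L 3 (Matrix.diagonal (α ∘ ⇑τ)) w))))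
    [∀ τ, (νH τ).IsHaarMeasure] [∀ τ, (νH τ).IsInvInvariant] (c : Perm (Fin 3) → ℂ) :
    haveI : ∀ τ : Perm (Fin 3), LocallyCompactSpace (archLocal L 3 (Matrix.diagonal (α ∘ ⇑τ)) w) := fun τ => locallyCompactSpace_archLocal L 3 (Matrix.diagonal (α ∘ ⇑τ)) w
    haveI : ∀ τ : Perm (Fin 3), SecondCountableTopology (archLocal L 3 (Matrix.diagonal (α ∘ ⇑τ)) w) := fun τ => secondCountableTopology_archLocal L 3 (Matrix.diagonal (α ∘ ⇑τ)) w
    haveI : ∀ τ : Perm (Fin 3), (ν.map (ContinuousMulEquiv.restrictSubgroup (GLn.conjEquiv (Matrix.GeneralLinearGroup.mkOfDetNeZero _ (det_monomial_one_ne_zero 3 τ)))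
        (archLocal L 3 (Matrix.diagonal (α ∘ ⇑τ)) w) (archLocal L 3 (Matrix.diagonal α) w)
        (mem_archLocal_comp_perm_iff_conj_mem L 3 α w τ)).symm).IsMulRightInvariant := fun τ => isMulRightInvariant_map_relabel_symm L 3 α w τ ν
    (∀ (τ : Perm (Fin 3)), (w.1.embedding (α (τ 0))).re * (w.1.embedding (α (τ 2))).re < 0 →
      ∀ (Θ : Matrix (Fin 3) (Fin 3) ℂ → ℂ), ContDiff ℝ (⊤ : ℕ∞) Θ →
        HasCompactSupport (fun k : archLocal L 3 (Matrix.diagonal (α ∘ ⇑τ)) w => Θ ((k : GL (Fin 3) ℂ) : Matrix (Fin 3) (Fin 3) ℂ)) →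
        ∀ (z₀ : Fin 3 → Circle) (h02' : z₀ 0 = z₀ 2) (h01' : z₀ 0 ≠ z₀ 1),
          Tendsto (fun ψ : ℝ => deriv (fun ψ : ℝ => (2 * Real.sin ψ : ℂ) *
              ∫ g, Θ (((g * ⟨circleDiagonal 3 (fun i => z₀ i * Circle.exp (![(1 : ℝ), 0, -1] i * ψ)),
                circleDiagonal_mem_archLocal_diagonal L 3 (α ∘ ⇑τ) w _⟩ * g⁻¹ : archLocal L 3 (Matrix.diagonal (α ∘ ⇑τ)) w) : GL (Fin 3) ℂ) : Matrix (Fin 3) (Fin 3) ℂ)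
                ∂(ν.map (ContinuousMulEquiv.restrictSubgroup (GLn.conjEquiv (Matrix.GeneralLinearGroup.mkOfDetNeZero _ (det_monomial_one_ne_zero 3 τ)))
        (archLocal L 3 (Matrix.diagonal (α ∘ ⇑τ)) w) (archLocal L 3 (Matrix.diagonal α) w)
        (mem_archLocal_comp_perm_iff_conj_mem L 3 α w τ)).symm)) ψ)
            (𝓝[≠] 0)
            (𝓝 (c τ * ∫ y, descConj (⟨circleDiagonal 3 z₀, circleDiagonal_mem_archLocal_diagonal L 3 (α ∘ ⇑τ) w z₀⟩ : archLocal L 3 (Matrix.diagonal (α ∘ ⇑τ)) w)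
              (Subgroup.centralizer ({(⟨circleDiagonal 3 z₁, circleDiagonal_mem_archLocal_diagonal L 3 (α ∘ ⇑τ) w z₁⟩ : archLocal L 3 (Matrix.diagonal (α ∘ ⇑τ)) w)} :
                Set (archLocal L 3 (Matrix.diagonal (α ∘ ⇑τ)) w)))
              (forall_mem_centralizer_circleDiagonal_comm_of_wall L (α ∘ ⇑τ) w h02 h01 h02' h01')
              (fun k : archLocal L 3 (Matrix.diagonal (α ∘ ⇑τ)) w => Θ ((k : GL (Fin 3) ℂ) : Matrix (Fin 3) (Fin 3) ℂ)) y
              ∂(quotientMeasure _ (νH τ) (isClosed_coe_centralizer_singleton _)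
                (ν.map (ContinuousMulEquiv.restrictSubgroup (GLn.conjEquiv (Matrix.GeneralLinearGroup.mkOfDetNeZero _ (det_monomial_one_ne_zero 3 τ)))
        (archLocal L 3 (Matrix.diagonal (α ∘ ⇑τ)) w) (archLocal L 3 (Matrix.diagonal α) w)
        (mem_archLocal_comp_perm_iff_conj_mem L 3 α w τ)).symm))))) →
      ∀ (Θ : Matrix (Fin 3) (Fin 3) ℂ → ℂ), ContDiff ℝ (⊤ : ℕ∞) Θ →
        HasCompactSupport (fun k : archLocal L 3 (Matrix.diagonal α) w => Θ ((k : GL (Fin 3) ℂ) : Matrix (Fin 3) (Fin 3) ℂ)) →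
        ∀ (z₀ : Fin 3 → Circle) (h02' : z₀ 0 = z₀ 2) (h01' : z₀ 0 ≠ z₀ 1),
          Tendsto (fun ψ : ℝ => deriv (fun ψ : ℝ => (2 * Real.sin ψ : ℂ) * ∑ ρ : Perm (Fin 3), ∫ g : archLocal L 3 (Matrix.diagonal α) w,
              Θ ((((g * ⟨circleDiagonal 3 ((fun i => z₀ i * Circle.exp (![(1 : ℝ), 0, -1] i * ψ)) ∘ ⇑ρ), circleDiagonal_mem_archLocal_diagonal L 3 α w _⟩ * g⁻¹ :
                archLocal L 3 (Matrix.diagonal α) w) : GL (Fin 3) ℂ) : Matrix (Fin 3) (Fin 3) ℂ)) ∂ν) ψ)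
            (𝓝[>] 0)
            (𝓝 (∑ ρ : Perm (Fin 3),
              if 0 < (w.1.embedding (α (ρ⁻¹ 0))).re * (w.1.embedding (α (ρ⁻¹ 2))).re then
                2 * ∫ g : archLocal L 3 (Matrix.diagonal α) w,
                  Θ ((((g * ⟨circleDiagonal 3 (z₀ ∘ ⇑ρ), circleDiagonal_mem_archLocal_diagonal L 3 α w _⟩ * g⁻¹ :
                    archLocal L 3 (Matrix.diagonal α) w) : GL (Fin 3) ℂ) : Matrix (Fin 3) (Fin 3) ℂ)) ∂ν
              else
                c ρ⁻¹ * ∫ y, descConj (⟨circleDiagonal 3 z₀, circleDiagonal_mem_archLocal_diagonal L 3 (α ∘ ⇑ρ⁻¹) w z₀⟩ : archLocal L 3 (Matrix.diagonal (α ∘ ⇑ρ⁻¹)) w)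
                  (Subgroup.centralizer ({(⟨circleDiagonal 3 z₁, circleDiagonal_mem_archLocal_diagonal L 3 (α ∘ ⇑ρ⁻¹) w z₁⟩ :
                    archLocal L 3 (Matrix.diagonal (α ∘ ⇑ρ⁻¹)) w)} : Set (archLocal L 3 (Matrix.diagonal (α ∘ ⇑ρ⁻¹)) w)))
                  (forall_mem_centralizer_circleDiagonal_comm_of_wall L (α ∘ ⇑ρ⁻¹) w h02 h01 h02' h01')
                  (fun k : archLocal L 3 (Matrix.diagonal (α ∘ ⇑ρ⁻¹)) w =>
                    Θ ((monomial ρ⁻¹ fun _ : Fin 3 => (1 : ℂ)) * ((k : GL (Fin 3) ℂ) : Matrix (Fin 3) (Fin 3) ℂ) *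
                      (((Matrix.GeneralLinearGroup.mkOfDetNeZero _ (det_monomial_one_ne_zero 3 ρ⁻¹))⁻¹ : GL (Fin 3) ℂ) : Matrix (Fin 3) (Fin 3) ℂ))) y
                  ∂(quotientMeasure _ (νH ρ⁻¹) (isClosed_coe_centralizer_singleton _)
                    (ν.map (ContinuousMulEquiv.restrictSubgroup (GLn.conjEquiv (Matrix.GeneralLinearGroup.mkOfDetNeZero _ (det_monomial_one_ne_zero 3 ρ⁻¹)))
                      (archLocal L 3 (Matrix.diagonal (α ∘ ⇑ρ⁻¹)) w) (archLocal L 3 (Matrix.diagonal α) w)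
                      (mem_archLocal_comp_perm_iff_conj_mem L 3 α w ρ⁻¹)).symm)))) := by
  classical
  haveI hLC : ∀ τ : Perm (Fin 3), LocallyCompactSpace (archLocal L 3 (Matrix.diagonal (α ∘ ⇑τ)) w) :=
    fun τ => locallyCompactSpace_archLocal L 3 (Matrix.diagonal (α ∘ ⇑τ)) w
  haveI hSC : ∀ τ : Perm (Fin 3), SecondCountableTopology (archLocal L 3 (Matrix.diagonal (α ∘ ⇑τ)) w) :=
    fun τ => secondCountableTopology_archLocal L 3 (Matrix.diagonal (α ∘ ⇑τ)) w
  haveI hRI : ∀ τ : Perm (Fin 3), (ν.map (ContinuousMulEquiv.restrictSubgroup (GLn.conjEquiv (Matrix.GeneralLinearGroup.mkOfDetNeZero _ (det_monomial_one_ne_zero 3 τ)))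
      (archLocal L 3 (Matrix.diagonal (α ∘ ⇑τ)) w) (archLocal L 3 (Matrix.diagonal α) w)
      (mem_archLocal_comp_perm_iff_conj_mem L 3 α w τ)).symm).IsMulRightInvariant := fun τ => isMulRightInvariant_map_relabel_symm L 3 α w τ ν
  intro hcl Θ hΘ hΘc z₀ h02' h01'
  have hΘ1 : ContDiff ℝ 1 Θ := hΘ.of_le (by exact_mod_cast le_top)
  have h12' : z₀ 1 ≠ z₀ 2 := fun h => h01' (h02'.trans h.symm)
  have hne : ∀ i : Fin 3, (w.1.embedding (α i)).re ≠ 0 := re_embedding_ne_zero L 3 α w hα hreal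
  -- `deriv Σ = Σ deriv` near `0⁺`, then the limits add
  refine (tendsto_finsetSum Finset.univ fun ρ _ => ?_).congr'
    ((eventually_deriv_sin_mul_sum_eq_sum_deriv L α w hα hreal ν Θ hΘ1 hΘc h02' h01').mono fun ψ hψ => hψ.symm)
  -- the term of `ρ`, in normal form on `G_w(α ∘ ρ⁻¹)`
  rw [sin_mul_integral_comp_conj_splitCurve_comp_perm_eq L α w ν Θ z₀ ρ]
  have hΘ' := contDiff_comp_monomial_conj 3 ρ⁻¹ Θ hΘ
  have hΘ'1 : ContDiff ℝ 1 (fun A : Matrix (Fin 3) (Fin 3) ℂ => Θ ((monomial ρ⁻¹ fun _ : Fin 3 => (1 : ℂ)) * A *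
      (((Matrix.GeneralLinearGroup.mkOfDetNeZero _ (det_monomial_one_ne_zero 3 ρ⁻¹))⁻¹ : GL (Fin 3) ℂ) : Matrix (Fin 3) (Fin 3) ℂ))) :=
    hΘ'.of_le (by exact_mod_cast le_top)
  have hΘ'c := hasCompactSupport_comp_relabel L 3 α w ρ⁻¹ Θ hΘc
  by_cases hP : 0 < (w.1.embedding (α (ρ⁻¹ 0))).re * (w.1.embedding (α (ρ⁻¹ 2))).re
  · -- COMPACT wall: ★ (J-cw) on `G_w(α ∘ ρ⁻¹)`, read back through the transport at `ψ = 0`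
    rw [if_pos hP, integral_comp_conj_circleDiagonal_comp_perm_eq_integral_ambient' L 3 α w ρ ν Θ z₀]
    have hcw := tendsto_deriv_sin_smul_integral_compactWall L (α ∘ ⇑ρ⁻¹) w
      (ν.map (ContinuousMulEquiv.restrictSubgroup (GLn.conjEquiv (Matrix.GeneralLinearGroup.mkOfDetNeZero _ (det_monomial_one_ne_zero 3 ρ⁻¹)))
        (archLocal L 3 (Matrix.diagonal (α ∘ ⇑ρ⁻¹)) w) (archLocal L 3 (Matrix.diagonal α) w)
        (mem_archLocal_comp_perm_iff_conj_mem L 3 α w ρ⁻¹)).symm)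
      (fun i => hα (ρ⁻¹ i)) (fun i => hreal (ρ⁻¹ i)) hP _ hΘ'1 hΘ'c h01' h12'
    simp only [Complex.real_smul, Complex.ofReal_mul, Complex.ofReal_ofNat] at hcw
    exact tendsto_nhdsWithin_of_tendsto_nhds hcw
  · -- NONCOMPACT wall: the LETTER on `G_w(α ∘ ρ⁻¹)`
    have hτ : (w.1.embedding (α (ρ⁻¹ 0))).re * (w.1.embedding (α (ρ⁻¹ 2))).re < 0 :=
      lt_of_le_of_ne (not_lt.mp hP) (mul_ne_zero (hne _) (hne _))
    rw [if_neg hP]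
    exact (hcl ρ⁻¹ hτ _ hΘ' hΘ'c z₀ h02' h01').mono_left (nhdsWithin_mono (0 : ℝ) fun x hx => Set.mem_compl_singleton_iff.mpr (ne_of_gt hx))

end OnePlace

/-! ## §2 (R1-e′)′: all places, orbit-measure currency -/

section AllPlaces

variable (L : Type) [Field L] [NumberField L] [IsCMField L] (α : Fin 3 → L) (w : {w : InfinitePlace L // IsComplex w})
  [MeasurableSpace (GL (Fin 3) ℂ)] [BorelSpace (GL (Fin 3) ℂ)]

open scoped Classical in
/-- **(R1-e′)′ THE ONE-STEP JUMP AT `w` IN ORBIT-MEASURE CURRENCY, WITH THE WALL CONSTANTS AS DATA** (clause-threaded form of ★ (R1-e′) p841391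
`exists_tendsto_deriv_sin_mul_sum_integral_pi_update_splitCurve`: same statement with `∃ c, (c ≠ 0) ∧ …` replaced by «for the given `c`, IF `c τ` satisfies the (J-nc) clause on every
relabelled group with a noncompact `{0,2}`-wall THEN …», same proof over J1′).  For every global test function `Θ`, every family `μ` of Radon measures on the `G_v` and every wall point
`z₀`: `∂_ψ [2 sin ψ · Σ_ρ I(μ[w ↦ ν.map conj_{γ_{z₀}(ψ)∘ρ}])] ⟶ Σ_ρ (cw: 2·I(μ[w ↦ ν.map conj_{z₀∘ρ}]) ∣ nc: c_{ρ⁻¹}·I(μ[w ↦ μ^{sing}_ρ]))` as `ψ → 0+`.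
[cite: Rogawski1990, §8.2 p. 124; §14.5 p. 238] [cite: Varadarajan1989, §6.4 Thm 22] [cite: BorelJacquet1979, §4.1] [cite: DeitmarEchterhoff2014, Lemma 9.3.3] -/
theorem tendsto_deriv_sin_mul_sum_integral_pi_update_splitCurve_of_clause
    (hα : ∀ i, α i ≠ 0) (hherm : ∀ i, (IsCMField.complexConj L (α i) : L) = α i)
    (ν : Measure (archLocal L 3 (Matrix.diagonal α) w)) [ν.IsHaarMeasure] [ν.IsMulRightInvariant]
    (z₁ : Fin 3 → Circle) (h02 : z₁ 0 = z₁ 2) (h01 : z₁ 0 ≠ z₁ 1)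
    [∀ τ : Perm (Fin 3), MeasurableSpace (archLocal L 3 (Matrix.diagonal (α ∘ ⇑τ)) w ⧸ Subgroup.centralizer
      ({(⟨circleDiagonal 3 z₁, circleDiagonal_mem_archLocal_diagonal L 3 (α ∘ ⇑τ) w z₁⟩ : archLocal L 3 (Matrix.diagonal (α ∘ ⇑τ)) w)} :
        Set (archLocal L 3 (Matrix.diagonal (α ∘ ⇑τ)) w)))]
    [∀ τ : Perm (Fin 3), BorelSpace (archLocal L 3 (Matrix.diagonal (α ∘ ⇑τ)) w ⧸ Subgroup.centralizer
      ({(⟨circleDiagonal 3 z₁, circleDiagonal_mem_archLocal_diagonal L 3 (α ∘ ⇑τ) w z₁⟩ : archLocal L 3 (Matrix.diagonal (α ∘ ⇑τ)) w)} :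
        Set (archLocal L 3 (Matrix.diagonal (α ∘ ⇑τ)) w)))]
    (νH : ∀ τ : Perm (Fin 3), Measure (Subgroup.centralizer
      ({(⟨circleDiagonal 3 z₁, circleDiagonal_mem_archLocal_diagonal L 3 (α ∘ ⇑τ) w z₁⟩ : archLocal L 3 (Matrix.diagonal (α ∘ ⇑τ)) w)} :
        Set (archLocal L 3 (Matrix.diagonal (α ∘ ⇑τ)) w))))
    [∀ τ, (νH τ).IsHaarMeasure] [∀ τ, (νH τ).IsInvInvariant] (c : Perm (Fin 3) → ℂ)
    [MeasurableSpace (arch (↥(maximalRealSubfield L)) L (IsCMField.complexConj L) 3 (Matrix.diagonal α))] [BorelSpace (arch (↥(maximalRealSubfield L)) L (IsCMField.complexConj L) 3 (Matrix.diagonal α))] :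
    haveI : ∀ τ : Perm (Fin 3), LocallyCompactSpace (archLocal L 3 (Matrix.diagonal (α ∘ ⇑τ)) w) := fun τ => locallyCompactSpace_archLocal L 3 (Matrix.diagonal (α ∘ ⇑τ)) w
    haveI : ∀ τ : Perm (Fin 3), SecondCountableTopology (archLocal L 3 (Matrix.diagonal (α ∘ ⇑τ)) w) := fun τ => secondCountableTopology_archLocal L 3 (Matrix.diagonal (α ∘ ⇑τ)) w
    haveI : ∀ τ : Perm (Fin 3), (ν.map (ContinuousMulEquiv.restrictSubgroup (GLn.conjEquiv (Matrix.GeneralLinearGroup.mkOfDetNeZero _ (det_monomial_one_ne_zero 3 τ)))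
            (archLocal L 3 (Matrix.diagonal (α ∘ ⇑τ)) w) (archLocal L 3 (Matrix.diagonal α) w)
            (mem_archLocal_comp_perm_iff_conj_mem L 3 α w τ)).symm).IsMulRightInvariant := fun τ => isMulRightInvariant_map_relabel_symm L 3 α w τ ν
    haveI : ∀ τ : Perm (Fin 3), (ν.map (ContinuousMulEquiv.restrictSubgroup (GLn.conjEquiv (Matrix.GeneralLinearGroup.mkOfDetNeZero _ (det_monomial_one_ne_zero 3 τ)))
            (archLocal L 3 (Matrix.diagonal (α ∘ ⇑τ)) w) (archLocal L 3 (Matrix.diagonal α) w)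
            (mem_archLocal_comp_perm_iff_conj_mem L 3 α w τ)).symm).IsHaarMeasure := fun _ => ContinuousMulEquiv.isHaarMeasure_map ν _
    (∀ (τ : Perm (Fin 3)), (w.1.embedding (α (τ 0))).re * (w.1.embedding (α (τ 2))).re < 0 →
      ∀ (Θ : Matrix (Fin 3) (Fin 3) ℂ → ℂ), ContDiff ℝ (⊤ : ℕ∞) Θ →
        HasCompactSupport (fun k : archLocal L 3 (Matrix.diagonal (α ∘ ⇑τ)) w => Θ ((k : GL (Fin 3) ℂ) : Matrix (Fin 3) (Fin 3) ℂ)) →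
        ∀ (z₀ : Fin 3 → Circle) (h02' : z₀ 0 = z₀ 2) (h01' : z₀ 0 ≠ z₀ 1),
          Tendsto (fun ψ : ℝ => deriv (fun ψ : ℝ => (2 * Real.sin ψ : ℂ) *
              ∫ g, Θ (((g * ⟨circleDiagonal 3 (fun i => z₀ i * Circle.exp (![(1 : ℝ), 0, -1] i * ψ)),
                circleDiagonal_mem_archLocal_diagonal L 3 (α ∘ ⇑τ) w _⟩ * g⁻¹ : archLocal L 3 (Matrix.diagonal (α ∘ ⇑τ)) w) : GL (Fin 3) ℂ) : Matrix (Fin 3) (Fin 3) ℂ)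
                ∂(ν.map (ContinuousMulEquiv.restrictSubgroup (GLn.conjEquiv (Matrix.GeneralLinearGroup.mkOfDetNeZero _ (det_monomial_one_ne_zero 3 τ)))
            (archLocal L 3 (Matrix.diagonal (α ∘ ⇑τ)) w) (archLocal L 3 (Matrix.diagonal α) w)
            (mem_archLocal_comp_perm_iff_conj_mem L 3 α w τ)).symm)) ψ)
            (𝓝[≠] 0)
            (𝓝 (c τ * ∫ y, descConj (⟨circleDiagonal 3 z₀, circleDiagonal_mem_archLocal_diagonal L 3 (α ∘ ⇑τ) w z₀⟩ : archLocal L 3 (Matrix.diagonal (α ∘ ⇑τ)) w)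
              (Subgroup.centralizer ({(⟨circleDiagonal 3 z₁, circleDiagonal_mem_archLocal_diagonal L 3 (α ∘ ⇑τ) w z₁⟩ : archLocal L 3 (Matrix.diagonal (α ∘ ⇑τ)) w)} :
                Set (archLocal L 3 (Matrix.diagonal (α ∘ ⇑τ)) w)))
              (forall_mem_centralizer_circleDiagonal_comm_of_wall L (α ∘ ⇑τ) w h02 h01 h02' h01')
              (fun k : archLocal L 3 (Matrix.diagonal (α ∘ ⇑τ)) w => Θ ((k : GL (Fin 3) ℂ) : Matrix (Fin 3) (Fin 3) ℂ)) y
              ∂(quotientMeasure _ (νH τ) (isClosed_coe_centralizer_singleton _)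
                (ν.map (ContinuousMulEquiv.restrictSubgroup (GLn.conjEquiv (Matrix.GeneralLinearGroup.mkOfDetNeZero _ (det_monomial_one_ne_zero 3 τ)))
            (archLocal L 3 (Matrix.diagonal (α ∘ ⇑τ)) w) (archLocal L 3 (Matrix.diagonal α) w)
            (mem_archLocal_comp_perm_iff_conj_mem L 3 α w τ)).symm))))) →
      ∀ (Θ : Matrix (Fin 3) (Fin 3) (mixedSpace L) → ℂ), ContDiff ℝ (⊤ : ℕ∞) Θ →
        HasCompactSupport (fun g : arch (↥(maximalRealSubfield L)) L (IsCMField.complexConj L) 3 (Matrix.diagonal α) => Θ ((g : GL (Fin 3) (mixedSpace L)) : Matrix (Fin 3) (Fin 3) (mixedSpace L))) →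
        ∀ (μall : ∀ v : {w : InfinitePlace L // IsComplex w}, Measure (archLocal L 3 (Matrix.diagonal α) v)) [∀ v, IsFiniteMeasureOnCompacts (μall v)] [∀ v, SigmaFinite (μall v)],
        ∀ (z₀ : Fin 3 → Circle) (h02' : z₀ 0 = z₀ 2) (h01' : z₀ 0 ≠ z₀ 1),
          Tendsto (fun ψ : ℝ => deriv (fun ψ : ℝ => (2 * Real.sin ψ : ℂ) * ∑ ρ : Perm (Fin 3),
              ∫ o, Θ ((((archPiEquivCM 3 L (Matrix.diagonal α)).symm o : arch (↥(maximalRealSubfield L)) L (IsCMField.complexConj L) 3 (Matrix.diagonal α)) : GL (Fin 3) (mixedSpace L)) : Matrix (Fin 3) (Fin 3) (mixedSpace L))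
              ∂(Measure.pi (Function.update μall w (ν.map fun y : archLocal L 3 (Matrix.diagonal α) w => y * (⟨circleDiagonal 3 ((fun i => z₀ i * Circle.exp (![(1 : ℝ), 0, -1] i * ψ)) ∘ ⇑ρ), circleDiagonal_mem_archLocal_diagonal L 3 α w ((fun i => z₀ i * Circle.exp (![(1 : ℝ), 0, -1] i * ψ)) ∘ ⇑ρ)⟩ : archLocal L 3 (Matrix.diagonal α) w) * y⁻¹)))) ψ)
            (𝓝[>] 0)
            (𝓝 (∑ ρ : Perm (Fin 3),
              if 0 < (w.1.embedding (α (ρ⁻¹ 0))).re * (w.1.embedding (α (ρ⁻¹ 2))).re then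
                2 * ∫ o, Θ ((((archPiEquivCM 3 L (Matrix.diagonal α)).symm o : arch (↥(maximalRealSubfield L)) L (IsCMField.complexConj L) 3 (Matrix.diagonal α)) : GL (Fin 3) (mixedSpace L)) : Matrix (Fin 3) (Fin 3) (mixedSpace L))
              ∂(Measure.pi (Function.update μall w (ν.map fun y : archLocal L 3 (Matrix.diagonal α) w => y * (⟨circleDiagonal 3 (z₀ ∘ ⇑ρ), circleDiagonal_mem_archLocal_diagonal L 3 α w (z₀ ∘ ⇑ρ)⟩ : archLocal L 3 (Matrix.diagonal α) w) * y⁻¹)))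
              else
                c ρ⁻¹ * ∫ o, Θ ((((archPiEquivCM 3 L (Matrix.diagonal α)).symm o : arch (↥(maximalRealSubfield L)) L (IsCMField.complexConj L) 3 (Matrix.diagonal α)) : GL (Fin 3) (mixedSpace L)) : Matrix (Fin 3) (Fin 3) (mixedSpace L))
              ∂(Measure.pi (Function.update μall w (((quotientMeasure _ (νH ρ⁻¹) (isClosed_coe_centralizer_singleton _) (ν.map (ContinuousMulEquiv.restrictSubgroup (GLn.conjEquiv (Matrix.GeneralLinearGroup.mkOfDetNeZero _ (det_monomial_one_ne_zero 3 ρ⁻¹)))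
            (archLocal L 3 (Matrix.diagonal (α ∘ ⇑ρ⁻¹)) w) (archLocal L 3 (Matrix.diagonal α) w)
            (mem_archLocal_comp_perm_iff_conj_mem L 3 α w ρ⁻¹)).symm)).map
                (descConj (⟨circleDiagonal 3 z₀, circleDiagonal_mem_archLocal_diagonal L 3 (α ∘ ⇑ρ⁻¹) w z₀⟩ : archLocal L 3 (Matrix.diagonal (α ∘ ⇑ρ⁻¹)) w)
                  (Subgroup.centralizer ({(⟨circleDiagonal 3 z₁, circleDiagonal_mem_archLocal_diagonal L 3 (α ∘ ⇑ρ⁻¹) w z₁⟩ :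
                    archLocal L 3 (Matrix.diagonal (α ∘ ⇑ρ⁻¹)) w)} : Set (archLocal L 3 (Matrix.diagonal (α ∘ ⇑ρ⁻¹)) w)))
                  (forall_mem_centralizer_circleDiagonal_comm_of_wall L (α ∘ ⇑ρ⁻¹) w h02 h01 h02' h01') id)).map
                (ContinuousMulEquiv.restrictSubgroup (GLn.conjEquiv (Matrix.GeneralLinearGroup.mkOfDetNeZero _ (det_monomial_one_ne_zero 3 ρ⁻¹)))
            (archLocal L 3 (Matrix.diagonal (α ∘ ⇑ρ⁻¹)) w) (archLocal L 3 (Matrix.diagonal α) w)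
            (mem_archLocal_comp_perm_iff_conj_mem L 3 α w ρ⁻¹))))))) := by
  classical
  haveI hLC : ∀ τ : Perm (Fin 3), LocallyCompactSpace (archLocal L 3 (Matrix.diagonal (α ∘ ⇑τ)) w) :=
    fun τ => locallyCompactSpace_archLocal L 3 (Matrix.diagonal (α ∘ ⇑τ)) w
  haveI hSC : ∀ τ : Perm (Fin 3), SecondCountableTopology (archLocal L 3 (Matrix.diagonal (α ∘ ⇑τ)) w) :=
    fun τ => secondCountableTopology_archLocal L 3 (Matrix.diagonal (α ∘ ⇑τ)) w
  haveI hLCv : ∀ v : {w : InfinitePlace L // IsComplex w}, LocallyCompactSpace (archLocal L 3 (Matrix.diagonal α) v) := fun v => locallyCompactSpace_archLocal L 3 (Matrix.diagonal α) v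
  haveI hSCv : ∀ v : {w : InfinitePlace L // IsComplex w}, SecondCountableTopology (archLocal L 3 (Matrix.diagonal α) v) := fun v => secondCountableTopology_archLocal L 3 (Matrix.diagonal α) v
  have hreal : ∀ i, (w.1.embedding (α i)).im = 0 := fun i => im_embedding_eq_zero_of_complexConj_eq L w (hherm i)
  intro hcl Θ hΘ hΘc μall _ _ z₀ h02' h01'
  have hJ1 := tendsto_deriv_sin_mul_sum_integral_comp_conj_splitCurve_comp_perm_of_clause L α w hα hreal ν z₁ h02 h01 νH c hcl
  -- the mixed partial integral over the places `v ≠ w` is the restriction of a per-place test function `Θ'` (★ (R1-a))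
  obtain ⟨Θ', hΘ'd, hΘ'c, hΘ'eq⟩ := exists_contDiff_eq_integral_insert L 3 α hα w (fun w' : {v : {w : InfinitePlace L // IsComplex w} // ¬ v = w} => μall w'.1) Θ hΘ hΘc
  -- (D) the regularity window at `w`
  obtain ⟨ε, hε, hregε⟩ : ∃ ε > 0, ∀ ψ : ℝ, 0 < ψ → ψ < ε → ∀ ρ : Perm (Fin 3),
      Function.Injective ((fun i => z₀ i * Circle.exp (![(1 : ℝ), 0, -1] i * ψ)) ∘ ⇑ρ) := by
    have h := (eventually_injective_splitCurve z₀ h02' h01').filter_mono (nhdsWithin_mono _ fun x (hx : 0 < x) => ne_of_gt hx)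
    rw [eventually_nhdsWithin_iff, Metric.eventually_nhds_iff] at h
    obtain ⟨ε, hε, h⟩ := h
    exact ⟨ε, hε, fun ψ h0 hψε ρ => (h (by rw [Real.dist_eq, sub_zero, abs_of_pos h0]; exact hψε) h0).comp ρ.injective⟩
  -- (E) on the window the state is J1's function at `Θ'`
  have hpt : ∀ ψ : ℝ, 0 < ψ → ψ < ε →
      (fun ψ : ℝ => (2 * Real.sin ψ : ℂ) * ∑ ρ : Perm (Fin 3),
        ∫ o, Θ ((((archPiEquivCM 3 L (Matrix.diagonal α)).symm o : arch (↥(maximalRealSubfield L)) L (IsCMField.complexConj L) 3 (Matrix.diagonal α)) :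
            GL (Fin 3) (mixedSpace L)) : Matrix (Fin 3) (Fin 3) (mixedSpace L))
          ∂(Measure.pi (Function.update μall w (ν.map fun y : archLocal L 3 (Matrix.diagonal α) w =>
            y * (⟨circleDiagonal 3 ((fun i => z₀ i * Circle.exp (![(1 : ℝ), 0, -1] i * ψ)) ∘ ⇑ρ), circleDiagonal_mem_archLocal_diagonal L 3 α w ((fun i => z₀ i * Circle.exp (![(1 : ℝ), 0, -1] i * ψ)) ∘ ⇑ρ)⟩ : archLocal L 3 (Matrix.diagonal α) w) * y⁻¹)))) ψ =
      (fun ψ : ℝ => (2 * Real.sin ψ : ℂ) * ∑ ρ : Perm (Fin 3), ∫ g : archLocal L 3 (Matrix.diagonal α) w,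
        Θ' ((((g * ⟨circleDiagonal 3 ((fun i => z₀ i * Circle.exp (![(1 : ℝ), 0, -1] i * ψ)) ∘ ⇑ρ), circleDiagonal_mem_archLocal_diagonal L 3 α w _⟩ * g⁻¹ :
          archLocal L 3 (Matrix.diagonal α) w) : GL (Fin 3) ℂ) : Matrix (Fin 3) (Fin 3) ℂ)) ∂ν) ψ := by
    intro ψ h0 hψε
    simp only []
    congr 1
    refine Finset.sum_congr rfl fun ρ _ => integral_pi_update_map_conj_eq_integral L α w μall ν _ (fun C hC => ?_) Θ hΘ.continuous hΘc Θ' hΘ'd.continuous hΘ'eq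
    exact isCompact_setOf_conj_circleDiagonal_mem_of_injective L 3 α w hα _ (hregε ψ h0 hψε ρ) C hC
  -- (F) hence the derivatives agree near `0+`, and J1's limit transfers
  have hev : ∀ᶠ ψ in 𝓝[>] (0 : ℝ),
      deriv (fun ψ : ℝ => (2 * Real.sin ψ : ℂ) * ∑ ρ : Perm (Fin 3), ∫ g : archLocal L 3 (Matrix.diagonal α) w,
        Θ' ((((g * ⟨circleDiagonal 3 ((fun i => z₀ i * Circle.exp (![(1 : ℝ), 0, -1] i * ψ)) ∘ ⇑ρ), circleDiagonal_mem_archLocal_diagonal L 3 α w _⟩ * g⁻¹ :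
          archLocal L 3 (Matrix.diagonal α) w) : GL (Fin 3) ℂ) : Matrix (Fin 3) (Fin 3) ℂ)) ∂ν) ψ =
      deriv (fun ψ : ℝ => (2 * Real.sin ψ : ℂ) * ∑ ρ : Perm (Fin 3),
        ∫ o, Θ ((((archPiEquivCM 3 L (Matrix.diagonal α)).symm o : arch (↥(maximalRealSubfield L)) L (IsCMField.complexConj L) 3 (Matrix.diagonal α)) :
            GL (Fin 3) (mixedSpace L)) : Matrix (Fin 3) (Fin 3) (mixedSpace L))
          ∂(Measure.pi (Function.update μall w (ν.map fun y : archLocal L 3 (Matrix.diagonal α) w =>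
            y * (⟨circleDiagonal 3 ((fun i => z₀ i * Circle.exp (![(1 : ℝ), 0, -1] i * ψ)) ∘ ⇑ρ), circleDiagonal_mem_archLocal_diagonal L 3 α w ((fun i => z₀ i * Circle.exp (![(1 : ℝ), 0, -1] i * ψ)) ∘ ⇑ρ)⟩ : archLocal L 3 (Matrix.diagonal α) w) * y⁻¹)))) ψ := by
    filter_upwards [Ioo_mem_nhdsGT hε] with ψ hψ
    refine Filter.EventuallyEq.deriv_eq ?_
    filter_upwards [isOpen_Ioo.mem_nhds hψ] with ψ' hψ'
    exact (hpt ψ' hψ'.1 hψ'.2).symm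
  have h2 := (hJ1 Θ' hΘ'd hΘ'c z₀ h02' h01').congr' hev
  convert h2 using 2
  refine Finset.sum_congr rfl fun ρ _ => ?_
  by_cases hρ : 0 < (w.1.embedding (α (ρ⁻¹ 0))).re * (w.1.embedding (α (ρ⁻¹ 2))).re
  · rw [if_pos hρ, if_pos hρ, integral_pi_update_map_conj_eq_integral L α w μall ν _ (fun C hC =>
      isCompact_setOf_conj_circleDiagonal_comp_perm_mem_of_compactWall L α w hα hreal z₀ h02' h01' ρ hρ C hC) Θ hΘ.continuous hΘc Θ' hΘ'd.continuous hΘ'eq]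
  · rw [if_neg hρ, if_neg hρ, integral_pi_update_singularOrbitMeasure_eq_integral_descConj L α w hα hherm μall ν ρ⁻¹ z₁ h02 h01 z₀ h02' h01' (νH ρ⁻¹)
      Θ hΘ.continuous hΘc Θ' hΘ'd.continuous hΘ'eq]

end AllPlaces

end Literature.NumberTheory.Rogawski1990

end
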